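import Summits.ResolutionOfSingularities.ResolutionOfSingularities.Theorems.WildConesCampaignW46ThreefoldsCharTwoSplittingRegime
import Summits.ResolutionOfSingularities.ResolutionOfSingularities.Theorems.WildConesCampaignW46ThreefoldsCharTwoFamily

/-!
# [OURS · L1 W4.6, rung (ii) at p = 2 — HONEST SCOPE MARKER] The forward transfer of isolatedness is
# special to THREEFOLDS: in five variables the order-2-cleaned regime is NOT closed under the point-blow-up
# dynamics (`z² = u₀u₁ + u₂³ + u₃³ + u₄³`), over EVERY field of characteristic 2

Cell res-hironaka (LADDER-RESOLUTION rung L, D-0089), slot W4.6, seat res-L1-s46-pv-4 (gen 2); host route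
`WildCones`, crux `ClassicalRegimes` (stmt-ResolutionOfSingularities-16884: «p = 2, n ≥ 3: … the dynamics of
z² + u₁u₂ + g(u'') is the suspended dynamics of z² + g(u''), and induction on n»). Companion of
`…CharTwoSplittingRegime` (p479260), whose CLOSURE theorem `threefold_isol_step_of_ordP` (an order-2-cleaned
isolated double point with a double successor has an ISOLATED successor) is stated for threefolds, `n = 3`.
THIS file shows the dimension restriction is REAL, not an artefact of the proof: for `n = 5` the analogous
statement FAILS. Order-2-cleanedness itself propagates in every dimension (`hypersurface_ordP_step_of_ordP`);
what breaks is isolatedness — after splitting off the hyperbolic pair `u₀u₁` the residual `g(u₂,u₃,u₄)` of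
order `3` behaves like a threefold point of cleaned order `≥ 3`, whose double successors are non-isolated
(Case A): the self-contained forced-regime picture of this seat's rung (ii)@p=2 files is a THREEFOLD phenomenon.

HONEST FRAMING. Everything here is OURS (route WildCones' own typed dynamics); NOTHING is a statement of
H. Hironaka's manuscript [Hironaka2017]; no FACT-LIST premise. AI review is weaker than expert review.

THE EXAMPLE (any field `κ` of characteristic `2`, `n = 5`). `a = u₀u₁ + u₂³ + u₃³ + u₄³`: cleaned, a double
point, order-2 cleaned (`u₀u₁`), ISOLATED (`∂a = (u₁, u₀, u₂², u₃², u₄²) ⊇ 𝔪⁴`; `μ = 8`). Blow up, chart `u₂`,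
translate to `u₃ = 1` (other coordinates `0`): `a∘Φ = u₂² · G`, `G = u₀u₁ + u₂u₃ + u₂u₃² + u₂u₃³ + u₂u₄³`
(characteristic two), unchanged by cleaning: a double point, order-2 cleaned (`u₀u₁`, `u₂u₃`), but NOT
isolated: `∂G = (u₁, u₀, u₃ + u₃² + u₃³ + u₄³, u₂(1 + u₃²), u₂u₄²) ⊆ (u₀, u₁, u₂, u₃ + u₃² + u₃³ + u₄³)` — four
non-units in five variables (Krull, `not_finite_quot_of_le_span`).

Main decl: `fivefold_splittingRegime_not_closed` — THE WITNESS: `∃ c i τ` (`n = 5`) with `Isol c ∧ MultP c ∧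
OrdP c ∧ MultP c' ∧ OrdP c' ∧ ¬ Isol c'` (`c' = step i τ c`); the other decls compute the example.
-/

noncomputable section

-- single-problem summit: the doubled namespace component `ResolutionOfSingularities` is forced
set_option linter.dupNamespace false

open scoped BigOperators Classical

open MvPowerSeries IsLocalRing

open Literature.AlgebraicGeometry.Resolution

namespace Summit.ResolutionOfSingularities.ResolutionOfSingularities.Theorems

namespace CampaignW46.ThreefoldsCharTwo

open WildCones WildCones.MuDropCharTwoOrdP

variable {κ : Type} [Field κ]

/-! ## The start state `u₀u₁ + u₂³ + u₃³ + u₄³` -/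

/-- Coefficients of `X₀X₁ + X₂³ + X₃³ + X₄³`. [folklore] -/
theorem coeff_fiveStart (A : Fin 5 →₀ ℕ) :
    coeff A ((X 0 * X 1 + X 2 ^ 3 + X 3 ^ 3 + X 4 ^ 3 : MvPowerSeries (Fin 5) κ)) =
      (if A = Finsupp.single 0 1 + Finsupp.single 1 1 then 1 else 0) + (if A = Finsupp.single 2 3 then 1 else 0) +
        (if A = Finsupp.single 3 3 then 1 else 0) + (if A = Finsupp.single 4 3 then 1 else 0) := by
  rw [map_add, map_add, map_add, X_pow_eq, X_pow_eq, X_pow_eq, X_def, X_def, monomial_mul_monomial, one_mul,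
    coeff_monomial, coeff_monomial, coeff_monomial, coeff_monomial]

/-- The start series has no monomial with all exponents even. [folklore] -/
theorem fiveStart_coeff_eq_zero_of_even (A : Fin 5 →₀ ℕ) (hA : ∀ j, 2 ∣ A j) :
    coeff A ((X 0 * X 1 + X 2 ^ 3 + X 3 ^ 3 + X 4 ^ 3 : MvPowerSeries (Fin 5) κ)) = 0 := by
  rw [coeff_fiveStart]
  have h0 : A ≠ Finsupp.single 0 1 + Finsupp.single 1 1 := by
    rintro rfl
    have := hA 0
    simp at this
  have h : ∀ s : Fin 5, A ≠ Finsupp.single s 3 := by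
    rintro s rfl
    have := hA s
    rw [Finsupp.single_eq_same] at this
    omega
  rw [if_neg h0, if_neg (h 2), if_neg (h 3), if_neg (h 4)]
  simp

/-- The pair exponent `e₀ + e₁` is not a cube exponent `3eₛ`. [folklore] -/
theorem five_pair_ne_cube (s : Fin 5) :
    (Finsupp.single 0 1 + Finsupp.single 1 1 : Fin 5 →₀ ℕ) ≠ Finsupp.single s 3 := by
  intro h
  have := congrArg Finsupp.degree h
  simp only [map_add, Finsupp.degree_single] at this
  omega

/-- The pair coefficient `[X₀X₁]` of the start series is `1`. [folklore] -/
theorem coeff_pair_fiveStart :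
    coeff (Finsupp.single 0 1 + Finsupp.single 1 1)
      ((X 0 * X 1 + X 2 ^ 3 + X 3 ^ 3 + X 4 ^ 3 : MvPowerSeries (Fin 5) κ)) = 1 := by
  rw [coeff_fiveStart, if_pos rfl, if_neg (five_pair_ne_cube 2), if_neg (five_pair_ne_cube 3),
    if_neg (five_pair_ne_cube 4)]
  simp

/-- [OURS · L1 W4.6] A state (`n = 5`) with cleaned series `u₀u₁ + u₂³ + u₃³ + u₄³` is a double point.
[folklore] -/
theorem multP_of_ser_eq_fiveStart {c : (Fin 5 → ℕ) → κ}
    (hc : ser 2 5 κ c = X 0 * X 1 + X 2 ^ 3 + X 3 ^ 3 + X 4 ^ 3) : MultP 2 5 κ c := by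
  rw [multP_iff_ser, hc]
  constructor
  · intro h
    have h1 := congrArg (coeff (Finsupp.single (0 : Fin 5) 1 + Finsupp.single 1 1)) h
    rw [coeff_pair_fiveStart, map_zero] at h1
    exact one_ne_zero h1
  · refine nat_le_order fun d hd => ?_
    rw [coeff_fiveStart]
    have h0 : d ≠ Finsupp.single 0 1 + Finsupp.single 1 1 := by
      rintro rfl
      simp only [map_add, Finsupp.degree_single] at hd
      omega
    have h : ∀ s : Fin 5, d ≠ Finsupp.single s 3 := by
      rintro s rfl
      rw [Finsupp.degree_single] at hd
      omega
    rw [if_neg h0, if_neg (h 2), if_neg (h 3), if_neg (h 4)]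
    simp

/-- [OURS · L1 W4.6] … and order-2 cleaned (`u₀u₁`). [folklore] -/
theorem ordP_of_ser_eq_fiveStart {c : (Fin 5 → ℕ) → κ}
    (hc : ser 2 5 κ c = X 0 * X 1 + X 2 ^ 3 + X 3 ^ 3 + X 4 ^ 3) : OrdP 2 5 κ c := by
  rw [ordP_two_iff_exists_pair, hc]
  exact ⟨0, 1, by decide, by rw [coeff_pair_fiveStart]; exact one_ne_zero⟩

/-- In characteristic two: `∂₀ a = X₁`, `∂₁ a = X₀`, `∂ₛ a = Xₛ²` (`s = 2, 3, 4`) for the start series.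
[folklore] -/
theorem pderiv_fiveStart [CharP κ 2] (s : Fin 5) :
    MvPowerSeries.pderiv s ((X 0 * X 1 + X 2 ^ 3 + X 3 ^ 3 + X 4 ^ 3 : MvPowerSeries (Fin 5) κ)) =
      if s = 0 then X 1 else if s = 1 then X 0 else X s ^ 2 := by
  have h3 : (3 : MvPowerSeries (Fin 5) κ) = 1 := by
    rw [show (3 : MvPowerSeries (Fin 5) κ) = 2 + 1 by norm_num, ← map_ofNat (C : κ →+* _) 2,
      CharTwo.two_eq_zero, map_zero, zero_add]
  rw [map_add, map_add, map_add, Derivation.leibniz, Derivation.leibniz_pow, Derivation.leibniz_pow,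
    Derivation.leibniz_pow, MvPowerSeries.pderiv_X, MvPowerSeries.pderiv_X, MvPowerSeries.pderiv_X,
    MvPowerSeries.pderiv_X, MvPowerSeries.pderiv_X]
  fin_cases s <;> simp [smul_eq_mul, h3]

/-- `𝔪⁴ ≤ (∂a)` for the start series: a monomial of degree `4` in five variables is divisible by `X₀`, by
`X₁`, or by the square of one of `X₂, X₃, X₄`. [folklore] -/
theorem maximalIdeal_pow_four_le_jac_fiveStart [CharP κ 2] :
    maximalIdeal (MvPowerSeries (Fin 5) κ) ^ 4 ≤
      Ideal.span (Set.range fun s : Fin 5 =>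
        MvPowerSeries.pderiv s ((X 0 * X 1 + X 2 ^ 3 + X 3 ^ 3 + X 4 ^ 3 : MvPowerSeries (Fin 5) κ))) := by
  rw [Literature.RingTheory.MvPowerSeries.Jets.maximalIdeal_pow_eq_span_monomial, Ideal.span_le]
  rintro _ ⟨e, he, rfl⟩
  change e.degree = 4 at he
  change (monomial e (1 : κ) : MvPowerSeries (Fin 5) κ) ∈ _
  -- membership of `X_s^k · (monomial)` once `k ≤ e s` and `X_s^k` is a generator
  have mem_of : ∀ (s : Fin 5) (k : ℕ), k ≤ e s →
      (X s : MvPowerSeries (Fin 5) κ) ^ k = MvPowerSeries.pderiv s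
        ((X 0 * X 1 + X 2 ^ 3 + X 3 ^ 3 + X 4 ^ 3 : MvPowerSeries (Fin 5) κ)) ∨
      (∃ s', (X s : MvPowerSeries (Fin 5) κ) ^ k = MvPowerSeries.pderiv s'
        ((X 0 * X 1 + X 2 ^ 3 + X 3 ^ 3 + X 4 ^ 3 : MvPowerSeries (Fin 5) κ))) →
      (monomial e (1 : κ) : MvPowerSeries (Fin 5) κ) ∈ Ideal.span (Set.range fun s : Fin 5 =>
        MvPowerSeries.pderiv s ((X 0 * X 1 + X 2 ^ 3 + X 3 ^ 3 + X 4 ^ 3 : MvPowerSeries (Fin 5) κ))) := by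
    intro s k hk hgen
    have hdec : (monomial e (1 : κ) : MvPowerSeries (Fin 5) κ) =
        monomial (e - Finsupp.single s k) (1 : κ) * X s ^ k := by
      rw [X_pow_eq, monomial_mul_monomial, one_mul, tsub_add_cancel_of_le]
      intro t
      by_cases hts : t = s
      · subst hts; rwa [Finsupp.single_eq_same]
      · rw [Finsupp.single_apply, if_neg (Ne.symm hts)]; exact Nat.zero_le _
    rw [hdec]
    rcases hgen with h | ⟨s', h⟩
    · exact Ideal.mul_mem_left _ _ (Ideal.subset_span ⟨s, h.symm⟩)
    · exact Ideal.mul_mem_left _ _ (Ideal.subset_span ⟨s', h.symm⟩)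
  by_cases h0 : 1 ≤ e 0
  · exact mem_of 0 1 h0 (Or.inr ⟨1, by rw [pderiv_fiveStart]; simp⟩)
  by_cases h1 : 1 ≤ e 1
  · exact mem_of 1 1 h1 (Or.inr ⟨0, by rw [pderiv_fiveStart]; simp⟩)
  -- `e 0 = e 1 = 0`, so `e 2 + e 3 + e 4 = 4` and one of them is `≥ 2`
  have hsum : e.degree = e 0 + e 1 + e 2 + e 3 + e 4 := by
    rw [degree_eq_sum_univ, Fin.sum_univ_five]
  by_cases h2 : 2 ≤ e 2
  · exact mem_of 2 2 h2 (Or.inl (by rw [pderiv_fiveStart]; simp))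
  by_cases h3 : 2 ≤ e 3
  · exact mem_of 3 2 h3 (Or.inl (by rw [pderiv_fiveStart]; simp))
  have h4 : 2 ≤ e 4 := by omega
  exact mem_of 4 2 h4 (Or.inl (by rw [pderiv_fiveStart]; simp))

/-- [OURS · L1 W4.6] **The start state is ISOLATED** (`μ = 8`): `(∂a) ⊇ 𝔪⁴`. [folklore] -/
theorem isol_of_ser_eq_fiveStart [CharP κ 2] {c : (Fin 5 → ℕ) → κ}
    (hc : ser 2 5 κ c = X 0 * X 1 + X 2 ^ 3 + X 3 ^ 3 + X 4 ^ 3) : Isol 2 5 κ c := by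
  rw [isol_iff_finite_pderiv, hc]
  haveI := Literature.RingTheory.MvPowerSeries.Jets.finite_quotient_maximalIdeal_pow
    (σ := Fin 5) (K := κ) 4
  exact Module.Finite.of_surjective
    (Ideal.Quotient.factorₐ κ maximalIdeal_pow_four_le_jac_fiveStart).toLinearMap
    (Ideal.Quotient.factor_surjective maximalIdeal_pow_four_le_jac_fiveStart)

/-! ## One step: chart `u₂`, translation to `u₃ = 1` -/

/-- The blow-up substitution `Φ_{2,τ}` (`τ₃ = 1`, else `0`) on the start series, characteristic two:
`a∘Φ = X₂² · (X₀X₁ + X₂X₃ + X₂X₃² + X₂X₃³ + X₂X₄³)`. [folklore] -/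
theorem subst_blowFam_fiveStart [CharP κ 2] :
    subst (fun s => if s = (2 : Fin 5) then (X 2 : MvPowerSeries (Fin 5) κ)
        else X 2 * (X s + C ((fun s : Fin 5 => if s = 3 then (1 : κ) else 0) s)))
      ((X 0 * X 1 + X 2 ^ 3 + X 3 ^ 3 + X 4 ^ 3 : MvPowerSeries (Fin 5) κ)) =
      X 2 ^ 2 * (X 0 * X 1 + X 2 * X 3 + X 2 * X 3 ^ 2 + X 2 * X 3 ^ 3 + X 2 * X 4 ^ 3) := by
  have ha := hasSubst_blowFam (κ := κ) (2 : Fin 5) (fun s : Fin 5 => if s = 3 then (1 : κ) else 0)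
  rw [subst_add ha, subst_add ha, subst_add ha, subst_mul ha, subst_pow ha, subst_pow ha, subst_pow ha,
    subst_X ha, subst_X ha, subst_X ha, subst_X ha, subst_X ha]
  rw [if_neg (show (0 : Fin 5) ≠ 2 by decide), if_neg (show (1 : Fin 5) ≠ 2 by decide), if_pos rfl,
    if_neg (show (3 : Fin 5) ≠ 2 by decide), if_neg (show (4 : Fin 5) ≠ 2 by decide)]
  simp only [show (0 : Fin 5) ≠ 3 by decide, show (1 : Fin 5) ≠ 3 by decide, show (4 : Fin 5) ≠ 3 by decide,
    if_true, if_false, map_one, map_zero, add_zero]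
  have h2 : (2 : MvPowerSeries (Fin 5) κ) = 0 := by
    rw [← map_ofNat (C : κ →+* _) 2, CharTwo.two_eq_zero, map_zero]
  linear_combination (X 2 ^ 3 * ((X 3 : MvPowerSeries (Fin 5) κ) ^ 2 + X 3 + 1)) * h2

/-- Coefficients of the successor series `X₀X₁ + X₂X₃ + X₂X₃² + X₂X₃³ + X₂X₄³`. [folklore] -/
theorem coeff_fiveStep (A : Fin 5 →₀ ℕ) :
    coeff A ((X 0 * X 1 + X 2 * X 3 + X 2 * X 3 ^ 2 + X 2 * X 3 ^ 3 + X 2 * X 4 ^ 3 :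
      MvPowerSeries (Fin 5) κ)) =
      (if A = Finsupp.single 0 1 + Finsupp.single 1 1 then 1 else 0) +
        (if A = Finsupp.single 2 1 + Finsupp.single 3 1 then 1 else 0) +
        (if A = Finsupp.single 2 1 + Finsupp.single 3 2 then 1 else 0) +
        (if A = Finsupp.single 2 1 + Finsupp.single 3 3 then 1 else 0) +
        (if A = Finsupp.single 2 1 + Finsupp.single 4 3 then 1 else 0) := by
  rw [map_add, map_add, map_add, map_add, X_pow_eq, X_pow_eq, X_pow_eq, X_def, X_def, X_def, X_def,
    monomial_mul_monomial, monomial_mul_monomial, monomial_mul_monomial, monomial_mul_monomial,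
    monomial_mul_monomial, one_mul, coeff_monomial, coeff_monomial, coeff_monomial, coeff_monomial,
    coeff_monomial]

/-- The successor series has no monomial with all exponents even. [folklore] -/
theorem fiveStep_coeff_eq_zero_of_even (A : Fin 5 →₀ ℕ) (hA : ∀ j, 2 ∣ A j) :
    coeff A ((X 0 * X 1 + X 2 * X 3 + X 2 * X 3 ^ 2 + X 2 * X 3 ^ 3 + X 2 * X 4 ^ 3 :
      MvPowerSeries (Fin 5) κ)) = 0 := by
  rw [coeff_fiveStep]
  have h0 : A ≠ Finsupp.single 0 1 + Finsupp.single 1 1 := by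
    rintro rfl
    have := hA 0
    simp at this
  have h : ∀ (s : Fin 5) (k : ℕ), s ≠ 2 → A ≠ Finsupp.single 2 1 + Finsupp.single s k := by
    rintro s k hs rfl
    have := hA 2
    rw [Finsupp.add_apply, Finsupp.single_eq_same, Finsupp.single_apply, if_neg hs, add_zero] at this
    omega
  rw [if_neg h0, if_neg (h 3 1 (by decide)), if_neg (h 3 2 (by decide)), if_neg (h 3 3 (by decide)),
    if_neg (h 4 3 (by decide))]
  simp

/-- The pair coefficient `[X₀X₁]` of the successor series is `1`. [folklore] -/
theorem coeff_pair_fiveStep :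
    coeff (Finsupp.single 0 1 + Finsupp.single 1 1)
      ((X 0 * X 1 + X 2 * X 3 + X 2 * X 3 ^ 2 + X 2 * X 3 ^ 3 + X 2 * X 4 ^ 3 : MvPowerSeries (Fin 5) κ)) = 1 := by
  rw [coeff_fiveStep, if_pos rfl]
  have h : ∀ (s : Fin 5) (k : ℕ),
      (Finsupp.single 0 1 + Finsupp.single 1 1 : Fin 5 →₀ ℕ) ≠ Finsupp.single 2 1 + Finsupp.single s k := by
    intro s k h'
    have := DFunLike.congr_fun h' 2
    simp [Finsupp.single_apply] at this
    split_ifs at this; omega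
  rw [if_neg (h 3 1), if_neg (h 3 2), if_neg (h 3 3), if_neg (h 4 3)]
  simp

/-- [OURS · L1 W4.6] **The step on the start state**: the successor in chart `u₂` at `u₃ ↦ u₃ + 1` has
cleaned series `u₀u₁ + u₂u₃ + u₂u₃² + u₂u₃³ + u₂u₄³`. [folklore] -/
theorem ser_step_of_ser_eq_fiveStart [CharP κ 2] {c : (Fin 5 → ℕ) → κ}
    (hc : ser 2 5 κ c = X 0 * X 1 + X 2 ^ 3 + X 3 ^ 3 + X 4 ^ 3) :
    ser 2 5 κ (step 2 5 κ 2 (fun s : Fin 5 => if s = 3 then (1 : κ) else 0) c) =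
      X 0 * X 1 + X 2 * X 3 + X 2 * X 3 ^ 2 + X 2 * X 3 ^ 3 + X 2 * X 4 ^ 3 := by
  have hM : MultP 2 5 κ c := multP_of_ser_eq_fiveStart hc
  have key := X_pow_mul_serT_eq_subst c 2 (fun s : Fin 5 => if s = 3 then (1 : κ) else 0) hM
  rw [hc, subst_blowFam_fiveStart] at key
  have hX2 : (X 2 : MvPowerSeries (Fin 5) κ) ≠ 0 := fun h => by
    have h1 := congrArg (coeff (Finsupp.single (2 : Fin 5) 1)) h
    rw [coeff_index_single_self_X, map_zero] at h1
    exact one_ne_zero h1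
  have hT := mul_left_cancel₀ (pow_ne_zero 2 hX2) key
  ext A
  rw [coeff_ser_step c 2 _ hM A]
  have hTA : tr 5 κ 2 (fun s : Fin 5 => if s = 3 then (1 : κ) else 0) 2
      (dv 5 κ 2 2 (bl 5 κ 2 (clean 2 5 κ c))) ⇑A =
      coeff A ((X 0 * X 1 + X 2 * X 3 + X 2 * X 3 ^ 2 + X 2 * X 3 ^ 3 + X 2 * X 4 ^ 3 :
        MvPowerSeries (Fin 5) κ)) := by
    rw [← hT]; rfl
  have clean_apply : ∀ (g : (Fin 5 → ℕ) → κ) (B : Fin 5 → ℕ),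
      clean 2 5 κ g B = @ite κ (∀ j, 2 ∣ B j) (Classical.dec _) 0 (g B) := fun _ _ => rfl
  rw [clean_apply]
  by_cases h : ∀ j, 2 ∣ (⇑A) j
  · rw [if_pos h, fiveStep_coeff_eq_zero_of_even A h]
  · rw [if_neg h, hTA]

/-- [OURS · L1 W4.6] The successor is a DOUBLE POINT. [folklore] -/
theorem multP_step_fiveStart [CharP κ 2] {c : (Fin 5 → ℕ) → κ}
    (hc : ser 2 5 κ c = X 0 * X 1 + X 2 ^ 3 + X 3 ^ 3 + X 4 ^ 3) :
    MultP 2 5 κ (step 2 5 κ 2 (fun s : Fin 5 => if s = 3 then (1 : κ) else 0) c) := by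
  rw [multP_iff_ser, ser_step_of_ser_eq_fiveStart hc]
  constructor
  · intro h
    have h1 := congrArg (coeff (Finsupp.single (0 : Fin 5) 1 + Finsupp.single 1 1)) h
    rw [coeff_pair_fiveStep, map_zero] at h1
    exact one_ne_zero h1
  · refine nat_le_order fun d hd => ?_
    rw [coeff_fiveStep]
    have h0 : d ≠ Finsupp.single 0 1 + Finsupp.single 1 1 := by
      rintro rfl
      simp only [map_add, Finsupp.degree_single] at hd
      omega
    have h : ∀ (s : Fin 5) (k : ℕ), 1 ≤ k → d ≠ Finsupp.single 2 1 + Finsupp.single s k := by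
      rintro s k hk rfl
      simp only [map_add, Finsupp.degree_single] at hd
      omega
    rw [if_neg h0, if_neg (h 3 1 le_rfl), if_neg (h 3 2 (by norm_num)), if_neg (h 3 3 (by norm_num)),
      if_neg (h 4 3 (by norm_num))]
    simp

/-- [OURS · L1 W4.6] The successor is ORDER-2 CLEANED (`u₀u₁`). [folklore] -/
theorem ordP_step_fiveStart [CharP κ 2] {c : (Fin 5 → ℕ) → κ}
    (hc : ser 2 5 κ c = X 0 * X 1 + X 2 ^ 3 + X 3 ^ 3 + X 4 ^ 3) :
    OrdP 2 5 κ (step 2 5 κ 2 (fun s : Fin 5 => if s = 3 then (1 : κ) else 0) c) := by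
  rw [ordP_two_iff_exists_pair, ser_step_of_ser_eq_fiveStart hc]
  exact ⟨0, 1, by decide, by rw [coeff_pair_fiveStep]; exact one_ne_zero⟩

/-- The partial derivatives of the successor series (characteristic two): `X₁`, `X₀`,
`X₃ + X₃² + X₃³ + X₄³`, `X₂(1 + X₃²)`, `X₂X₄²` — all in the ideal `(X₀, X₁, X₂, X₃ + X₃² + X₃³ + X₄³)`.
[folklore] -/
theorem pderiv_fiveStep_mem [CharP κ 2] (s : Fin 5) :
    MvPowerSeries.pderiv s ((X 0 * X 1 + X 2 * X 3 + X 2 * X 3 ^ 2 + X 2 * X 3 ^ 3 + X 2 * X 4 ^ 3 :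
      MvPowerSeries (Fin 5) κ)) ∈
      Ideal.span ({X 0, X 1, X 2, X 3 + X 3 ^ 2 + X 3 ^ 3 + X 4 ^ 3} : Set (MvPowerSeries (Fin 5) κ)) := by
  have h2 : (2 : MvPowerSeries (Fin 5) κ) = 0 := by
    rw [← map_ofNat (C : κ →+* _) 2, CharTwo.two_eq_zero, map_zero]
  have h3 : (3 : MvPowerSeries (Fin 5) κ) = 1 := by
    rw [show (3 : MvPowerSeries (Fin 5) κ) = 2 + 1 by norm_num, h2, zero_add]
  have hX0 : (X 0 : MvPowerSeries (Fin 5) κ) ∈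
      Ideal.span ({X 0, X 1, X 2, X 3 + X 3 ^ 2 + X 3 ^ 3 + X 4 ^ 3} : Set (MvPowerSeries (Fin 5) κ)) :=
    Ideal.subset_span (by simp)
  have hX1 : (X 1 : MvPowerSeries (Fin 5) κ) ∈
      Ideal.span ({X 0, X 1, X 2, X 3 + X 3 ^ 2 + X 3 ^ 3 + X 4 ^ 3} : Set (MvPowerSeries (Fin 5) κ)) :=
    Ideal.subset_span (by simp)
  have hX2 : (X 2 : MvPowerSeries (Fin 5) κ) ∈
      Ideal.span ({X 0, X 1, X 2, X 3 + X 3 ^ 2 + X 3 ^ 3 + X 4 ^ 3} : Set (MvPowerSeries (Fin 5) κ)) :=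
    Ideal.subset_span (by simp)
  have hh : (X 3 + X 3 ^ 2 + X 3 ^ 3 + X 4 ^ 3 : MvPowerSeries (Fin 5) κ) ∈
      Ideal.span ({X 0, X 1, X 2, X 3 + X 3 ^ 2 + X 3 ^ 3 + X 4 ^ 3} : Set (MvPowerSeries (Fin 5) κ)) :=
    Ideal.subset_span (by simp)
  rw [map_add, map_add, map_add, map_add, Derivation.leibniz, Derivation.leibniz, Derivation.leibniz,
    Derivation.leibniz, Derivation.leibniz, Derivation.leibniz_pow, Derivation.leibniz_pow,
    Derivation.leibniz_pow, MvPowerSeries.pderiv_X, MvPowerSeries.pderiv_X, MvPowerSeries.pderiv_X,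
    MvPowerSeries.pderiv_X, MvPowerSeries.pderiv_X]
  fin_cases s
  · simp only [smul_eq_mul]; simp; exact hX1
  · simp only [smul_eq_mul]; simp; exact hX0
  · simp only [smul_eq_mul]; simp
    convert hh using 1
  · simp only [smul_eq_mul]; simp [h2, h3]
    convert Ideal.mul_mem_right ((1 : MvPowerSeries (Fin 5) κ) + X 3 ^ 2) _ hX2 using 1
    ring
  · simp only [smul_eq_mul]; simp [h3]
    convert Ideal.mul_mem_right ((X 4 : MvPowerSeries (Fin 5) κ) ^ 2) _ hX2 using 1

/-- [OURS · L1 W4.6; NOT a statement of the manuscript] **The successor is NOT ISOLATED**: its gradient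
ideal lies in `(X₀, X₁, X₂, X₃ + X₃² + X₃³ + X₄³)`, four non-units in five variables, whose quotient is not
finite over `κ` (Krull's height theorem, `not_finite_quot_of_le_span`). [folklore] -/
theorem not_isol_step_fiveStart [CharP κ 2] {c : (Fin 5 → ℕ) → κ}
    (hc : ser 2 5 κ c = X 0 * X 1 + X 2 ^ 3 + X 3 ^ 3 + X 4 ^ 3) :
    ¬ Isol 2 5 κ (step 2 5 κ 2 (fun s : Fin 5 => if s = 3 then (1 : κ) else 0) c) := by
  rw [isol_iff_finite_pderiv, ser_step_of_ser_eq_fiveStart hc]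
  refine not_finite_quot_of_le_span
    ({X 0, X 1, X 2, X 3 + X 3 ^ 2 + X 3 ^ 3 + X 4 ^ 3} : Finset (MvPowerSeries (Fin 5) κ)) ?_ ?_ ?_
  · intro x hx
    simp only [Finset.coe_insert, Finset.coe_singleton, Set.mem_insert_iff, Set.mem_singleton_iff] at hx
    rw [SetLike.mem_coe,
      Literature.RingTheory.MvPowerSeries.Jets.mem_maximalIdeal_iff_constantCoeff_eq_zero]
    rcases hx with rfl | rfl | rfl | rfl
    · exact constantCoeff_X _
    · exact constantCoeff_X _
    · exact constantCoeff_X _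
    · simp [constantCoeff_X]
  · exact lt_of_le_of_lt Finset.card_le_four (by norm_num)
  · rw [Finset.coe_insert, Finset.coe_insert, Finset.coe_insert, Finset.coe_singleton, Ideal.span_le]
    rintro _ ⟨s, rfl⟩
    exact pderiv_fiveStep_mem s

/-! ## The witness -/

/-- [OURS · L1 W4.6 rung (ii) at `p = 2`, HONEST SCOPE MARKER; NOT a statement of the manuscript]
**IN FIVE VARIABLES THE ORDER-2-CLEANED REGIME IS NOT CLOSED.** Over EVERY field of characteristic `2` there
is an order-2-cleaned ISOLATED double point `c` of `z² = a(u₀,…,u₄)` (`a = u₀u₁ + u₂³ + u₃³ + u₄³`) with a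
chart/translation whose successor `c'` is an order-2-cleaned double point that is NOT isolated. Contrast:
for threefolds (`n = 3`) this is impossible (`threefold_isol_step_of_ordP`, p479260). The forced-regime
picture of rung (ii)@p=2 is a threefold phenomenon; the crux's induction on `n` through the suspension
`z² + u₀u₁ + g(u'')` runs through non-isolated states in general. [folklore] -/
theorem fivefold_splittingRegime_not_closed (κ : Type) [Field κ] [CharP κ 2] :
    ∃ (c : (Fin 5 → ℕ) → κ) (i : Fin 5) (τ : Fin 5 → κ),
      Isol 2 5 κ c ∧ MultP 2 5 κ c ∧ OrdP 2 5 κ c ∧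
        MultP 2 5 κ (step 2 5 κ i τ c) ∧ OrdP 2 5 κ (step 2 5 κ i τ c) ∧ ¬ Isol 2 5 κ (step 2 5 κ i τ c) := by
  obtain ⟨c, hc⟩ := exists_ser_eq (κ := κ)
    ((X 0 * X 1 + X 2 ^ 3 + X 3 ^ 3 + X 4 ^ 3 : MvPowerSeries (Fin 5) κ)) fiveStart_coeff_eq_zero_of_even
  exact ⟨c, 2, fun s => if s = 3 then 1 else 0, isol_of_ser_eq_fiveStart hc, multP_of_ser_eq_fiveStart hc,
    ordP_of_ser_eq_fiveStart hc, multP_step_fiveStart hc, ordP_step_fiveStart hc, not_isol_step_fiveStart hc⟩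

end CampaignW46.ThreefoldsCharTwo

end Summit.ResolutionOfSingularities.ResolutionOfSingularities.Theorems

end
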